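import Summits.QuantumFields.YangMills.Theorems.TwistEaterVolumeQuadraticGrowthQuaternion
import Summits.QuantumFields.YangMills.Theorems.TwistEaterVolumeQuadraticGrowthRing
import Summits.QuantumFields.YangMills.Theorems.ToronValleyVolumeLojasiewiczLocalise
import Summits.QuantumFields.YangMills.Theses.TwistEaterVolume
import HarnessLib

/-!
# ★★★ Crux `TwistEaterVolume.QuadraticGrowth` (item stmt-QuantumFields-24320, LINE g15-A of ym-idea-4): QUADRATIC GROWTH of the twisted periodic deficit —
# the LINEAR (Hölder exponent `1`) polynomial Łojasiewicz localisation `dist(P, {F_z = 0}) ≤ 250000·L⁸·F_z(P)` for every twist `z ≠ 0`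

For `L ≥ 2`, a non-trivial twist `z` and a `2L`-slice ring history `P` with twisted periodic deficit `ε = F_z(P)` (✓`RingDeficit.ringDeficit L z`): the squared chordal
ring distance from `P` to `{F_z = 0}` is at most `250000·L⁸·ε`.  The twisted zero set is RIGID (twist-eaters), which is why the exponent is `1`:
1. ✓`ringDeficit_eq_sums`: every bond deficit, the twisted seam deficit and `½S(P₀)` are `≤ ε`; slices are `4L√ε`-close to `P₀` per link, and the seam field `g`
   moves the twisted slice `τ_z P₀` to within `ρ = 4L√ε` of `P₀` per link (✓`…QuadraticGrowthRing`).
2. Lane A's comb propagation on `P₀` (✓`fd_treeFix_combFlat_le`, ✓`fd_comm_wrapReps_le`): `V = treeFix P₀` is within `12L²√ε` of `combFlat w`, the wraps almost commute.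
3. TWISTED SEAM: with the central sign field `λ` of ✓`exists_twistSign`, the field `λ⁻¹·(tgt⁻¹)` jumps by `≤ ρ` across the comb's tree edges (the twist factor of a tree
   link is exactly the jump of `λ`), hence is within `3(L−1)ρ` of `c = s(0)`; on the three wrap edges `c w_k c⁻¹ ≈ centreElem(z_k)·w_k` within `3Lρ`.
4. ✓`exists_twisted_solution_near` (LINEAR stability, the new algebraic input): `(c; w)` is within `80L²√ε` (quaternion norm) of an EXACT solution `(c′; w′)` of
   `[w′_i,w′_j] = 1`, `c′w′_kc′⁻¹ = centreElem(z_k)w′_k`; the ring `Q = (t⁻¹·combFlat w′ on all slices; seam x ↦ t(x)⁻¹λ(x)c′t(x))` has `F_z(Q) = 0` (the sign field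
   carries the twist from the planes `x_k = 0` to the wrap links).
5. Summing `2 − Re tr ≤ fd²` over `6L⁴` slice links and `L³` seam sites: `≤ 250000·L⁸·ε`.
HONEST FRAMING: a classical (zero-ℏ) inequality for the lattice Wilson action of twisted ring histories; the sibling crux ⟨24319⟩ `TubeVolumeLaw`, the leaf ⟨24204⟩
`SharpTwistedLaplace`, every rung and the Yang–Mills mass gap remain OPEN; no summit is proved by a line.  THEOREMS ONLY, no `sorry`.
-/

set_option autoImplicit false

noncomputable section

open scoped Quaternion Matrix BigOperators
open Literature.MathematicalPhysics.QuantumFieldTheory hiding SU2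
open Literature.MathematicalPhysics.QuantumLattice

namespace Summit.QuantumFields.YangMills.Theorems.TwistEaterVolume.Quadratic

open Summit.QuantumFields.YangMills.Theorems.FemtoTransferGap
open Summit.QuantumFields.YangMills.Theorems.FemtoTransferGap.TT
open Summit.QuantumFields.YangMills.Theorems.FemtoTransferGap.TwoLattice
open Summit.QuantumFields.YangMills.Theorems.FemtoTransferGap.TwoLattice.Flat
open Summit.QuantumFields.YangMills.Theorems.FemtoTransferGap.TwoLattice.Cov
open Summit.QuantumFields.YangMills.Theorems.VirialFluxGap.RingDeficit
open Summit.QuantumFields.YangMills.Theorems.ToronValleyVolume.Lojasiewicz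

variable {L : ℕ} [NeZero L]

/-! ## §1 ★★ The flat twisted comparison ring -/

set_option maxHeartbeats 1600000 in
-- one long construction (comb gauge, twisted seam, linear stability, flat twisted ring)
/-- ★★ **A flat TWISTED ring history near every small-deficit ring history.**  For `L ≥ 2`, `z ≠ 0` and `δ = √F_z(P)`: there is `Q` with `F_z(Q) = 0` whose slices are
within `176L²δ` of the slices of `P` on every link (Frobenius) and whose seam field is within `172L²δ` of the seam field of `P` at every site. [cite: Luscher1983, §2] -/
theorem exists_flat_twisted_ring_near (hL : 2 ≤ L) (z : Fin 3 → Bool) (hz : z ≠ fun _ => false)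
    (P : (Fin (2 * L - 1 + 1) → GaugeConfig 3 L SU2) × (Site 3 L → SU2)) :
    ∃ Q : (Fin (2 * L - 1 + 1) → GaugeConfig 3 L SU2) × (Site 3 L → SU2),
      ringDeficit L z Q = 0 ∧
      (∀ (i : Fin (2 * L - 1 + 1)) (e : Edge 3 L), fd (P.1 i e) (Q.1 i e) ≤ 176 * (L : ℝ) ^ 2 * Real.sqrt (ringDeficit L z P)) ∧
      (∀ x : Site 3 L, fd (P.2 x) (Q.2 x) ≤ 172 * (L : ℝ) ^ 2 * Real.sqrt (ringDeficit L z P)) := by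
  set δ := Real.sqrt (ringDeficit L z P) with hδ
  have hδ0 : 0 ≤ δ := Real.sqrt_nonneg _
  have hL1 : (1 : ℝ) ≤ L := by exact_mod_cast NeZero.one_le
  have hL0 : (0 : ℝ) ≤ (L : ℝ) - 1 := by linarith
  have hLL : (L : ℝ) ≤ (L : ℝ) ^ 2 := by nlinarith
  -- a twisted direction
  obtain ⟨k₀, hk₀⟩ : ∃ k₀, z k₀ = true := by
    by_contra hcon
    push Not at hcon
    exact hz (funext fun k => by simpa using hcon k)
  set U : GaugeConfig 3 L SU2 := P.1 0 with hU
  set g : Site 3 L → SU2 := P.2 with hg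
  set ρ : ℝ := 4 * (L : ℝ) * δ with hρ
  have hρ0 : 0 ≤ ρ := by positivity
  -- inputs from `…QuadraticGrowthRing` §1
  have hslice : ∀ i e, fd (P.1 i e) (U e) ≤ 4 * (L : ℝ) * δ := fun i e => fd_slice_zero_le_twist' z P i e
  have hseam : ∀ e, fd (U e) (gaugeTransform g (twist3 z U) e) ≤ ρ := fun e => fd_seam_twist_le z P e
  have hS : Real.sqrt (2 * wilsonAction su2Rep U) ≤ 2 * δ := sqrt_two_action_le_twist z P
  -- comb gauge of slice 0
  set t : Site 3 L → SU2 := treeGauge U with ht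
  have hV : treeFix U = gaugeTransform t U := rfl
  set w : Fin 3 → SU2 := wrapReps U with hw
  have hVw : ∀ e, fd (treeFix U e) (combFlat w e) ≤ 12 * (L : ℝ) ^ 2 * δ := fun e => by
    refine (fd_treeFix_combFlat_le U e).trans ?_
    have h1 : ((L : ℝ) - 1) * ((6 * (L : ℝ) - 4) * Real.sqrt (2 * wilsonAction su2Rep U)) ≤ ((L : ℝ) - 1) * ((6 * (L : ℝ) - 4) * (2 * δ)) :=
      mul_le_mul_of_nonneg_left (mul_le_mul_of_nonneg_left hS (by linarith)) hL0
    nlinarith [h1]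
  have hww : ∀ i j, fd (w i * w j * (w i)⁻¹ * (w j)⁻¹) 1 ≤ 20 * (L : ℝ) ^ 2 * δ := fun i j => by
    refine (fd_comm_wrapReps_le U i j).trans ?_
    have hC : combC L ≤ 10 * (L : ℝ) ^ 2 := by unfold combC; nlinarith
    have hC0 : 0 ≤ combC L := le_trans zero_le_one one_le_combC
    calc combC L * Real.sqrt (2 * wilsonAction su2Rep U) ≤ combC L * (2 * δ) := mul_le_mul_of_nonneg_left hS hC0
      _ ≤ 10 * (L : ℝ) ^ 2 * (2 * δ) := mul_le_mul_of_nonneg_right hC (by positivity)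
      _ = 20 * (L : ℝ) ^ 2 * δ := by ring
  -- the twist sign field and the conjugated seam field
  obtain ⟨lam, hlamc, hlam0, hlamflip, hlamstay⟩ := exists_twistSign hL z
  have hlcomm : ∀ (x : Site 3 L) (a : SU2), lam x * a = a * lam x := fun x a => centre_comm (hlamc x) a
  set s : Site 3 L → SU2 := fun x => t x * g x * (t x)⁻¹ with hs
  set sl : Site 3 L → SU2 := fun x => (lam x)⁻¹ * s x with hsl
  have hsV : ∀ e, fd (treeFix U e) (gaugeTransform s (twist3 z (treeFix U)) e) ≤ ρ := fun e => by
    rw [hV, ← gaugeTransform_twist3, hs, gaugeTransform_conj_eq, fd_gaugeTransform_apply]; exact hseam e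
  -- jumps of `sl` across tree edges
  have hjump : ∀ e : Edge 3 L, treeEdge e = true → fd (sl (e.1.shift e.2)) (sl e.1) ≤ ρ := by
    intro e he
    obtain ⟨x, k⟩ := e
    have h1 := hsV (x, k)
    -- the tree link: `V e = 1`, twist factor `ζ = if x_k = 0 then centreElem (z k) else 1`
    have hxk : x k ≠ -1 := by
      rw [treeEdge_iff] at he
      rcases he with ⟨hk, h⟩ | ⟨hk, -, h⟩ | ⟨hk, -, -, h⟩ <;> simp only at hk <;> subst hk <;> exact h
    have hVe : treeFix U (x, k) = 1 := treeFix_eq_one_of_treeEdge U he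
    set ζ : SU2 := (if x k = 0 then centreElem (z k) else 1) with hζ
    have hζc : ∀ a : SU2, ζ * a = a * ζ := fun a => by
      rw [hζ]; split_ifs
      · exact centre_comm (centreElem_mem_center (z k)) a
      · rw [one_mul, mul_one]
    have htw : twist3 z (treeFix U) (x, k) = ζ := by rw [twist3_apply, hVe, mul_one]
    have e1 : gaugeTransform s (twist3 z (treeFix U)) (x, k) = s x * ζ * (s (x.shift k))⁻¹ := by
      rw [show gaugeTransform s (twist3 z (treeFix U)) (x, k) = s x * twist3 z (treeFix U) (x, k) * (s (x.shift k))⁻¹ from rfl, htw]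
    rw [hVe, e1] at h1
    -- `λ(y) = λ(x)·ζ` on a tree edge
    have hly : lam (x.shift k) = lam x * ζ := by
      by_cases h0 : x k = 0
      · rw [hlamflip x k (Or.inl h0), hζ, if_pos h0]
      · rw [hlamstay x k h0 hxk, hζ, if_neg h0, mul_one]
    -- `fd(sl y, sl x) = fd(s y, ζ s x) = fd(1, s x ζ (s y)⁻¹)`
    have e2 : fd (sl (x.shift k)) (sl x) = fd (s (x.shift k)) (ζ * s x) := by
      show fd ((lam (x.shift k))⁻¹ * s (x.shift k)) ((lam x)⁻¹ * s x) = _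
      rw [← fd_mul_left (lam (x.shift k)) ((lam (x.shift k))⁻¹ * s (x.shift k)) ((lam x)⁻¹ * s x), mul_inv_cancel_left, hly, hlcomm x ζ,
        mul_assoc, mul_inv_cancel_left]
    have e3 : fd (s (x.shift k)) (ζ * s x) = fd 1 (s x * ζ * (s (x.shift k))⁻¹) := by
      rw [← fd_mul_right (s (x.shift k))⁻¹ (s (x.shift k)) (ζ * s x), mul_inv_cancel, hζc, mul_assoc]
    rw [show ((x, k) : Edge 3 L).1 = x from rfl, show ((x, k) : Edge 3 L).2 = k from rfl, e2, e3]
    exact h1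
  set c : SU2 := s 0 with hc
  have hsl0 : sl 0 = c := by show (lam 0)⁻¹ * s 0 = c; rw [hlam0, inv_one, one_mul]
  have hslc : ∀ x, fd (sl x) c ≤ 3 * ((L : ℝ) - 1) * ρ := fun x => by
    have := fd_sub_base_le_of_treeEdge hρ0 hjump x
    rwa [hsl0] at this
  -- the wrap edges: `c w_k c⁻¹ ≈ centreElem(z k) · w_k`
  have hcw : ∀ k : Fin 3, fd (c * w k * c⁻¹) (centreElem (z k) * w k) ≤ 12 * (L : ℝ) ^ 2 * δ := by
    intro k
    set m : Site 3 L := mk3 (if k = 0 then (-1 : ZMod L) else 0) (if k = 1 then (-1 : ZMod L) else 0) (if k = 2 then (-1 : ZMod L) else 0) with hm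
    have hwk : w k = treeFix U (m, k) := by rw [hw, wrapReps_eq]
    have hshift : m.shift k = 0 := wrapEdge_shift k
    have hmk : m k = -1 := by rw [hm]; fin_cases k <;> simp [mk3]
    haveI : Fact (1 < L) := ⟨hL⟩
    have hm0 : m k ≠ 0 := by
      rw [hmk]; intro h
      have : ((1 : ZMod L)) = 0 := by rw [← neg_neg (1 : ZMod L), h, neg_zero]
      have hv := ZMod.val_one L
      rw [this, ZMod.val_zero] at hv
      exact zero_ne_one hv
    -- the sign field at `m`: `λ(0) = λ(m) · centreElem (z k)` (wrap flip), so `λ(m) = centreElem (z k)`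
    have hlm : lam m = centreElem (z k) := by
      have h := hlamflip m k (Or.inr hmk)
      rw [hshift, hlam0] at h
      have h2 : lam m * centreElem (z k) * centreElem (z k) = centreElem (z k) := by rw [← h, one_mul]
      rwa [mul_assoc, centreElem_mul_self, mul_one] at h2
    have h1 := hsV (m, k)
    have htw : twist3 z (treeFix U) (m, k) = w k := by rw [twist3_apply, if_neg hm0, one_mul, hwk]
    have e1 : gaugeTransform s (twist3 z (treeFix U)) (m, k) = s m * w k * c⁻¹ := by
      rw [show gaugeTransform s (twist3 z (treeFix U)) (m, k) = s m * twist3 z (treeFix U) (m, k) * (s (m.shift k))⁻¹ from rfl, htw, hshift]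
    rw [← hwk, e1] at h1
    -- `s m = λ(m) · sl m = centreElem(z k) · sl m`
    have hsm : s m = centreElem (z k) * sl m := by show s m = centreElem (z k) * ((lam m)⁻¹ * s m); rw [hlm, mul_inv_cancel_left]
    rw [hsm] at h1
    -- `fd(w, ε sl_m w c⁻¹) ≤ ρ` and `fd(ε sl_m w c⁻¹, ε c w c⁻¹) = fd(sl_m, c)`
    have h2 : fd (centreElem (z k) * sl m * w k * c⁻¹) (centreElem (z k) * c * w k * c⁻¹) = fd (sl m) c := by
      rw [fd_mul_right, fd_mul_right, fd_mul_left]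
    have h3 := hslc m
    have hεc : ∀ a : SU2, centreElem (z k) * a = a * centreElem (z k) := fun a => centre_comm (centreElem_mem_center (z k)) a
    -- `fd(c w c⁻¹, ε w) = fd(ε c w c⁻¹, w)`: multiply both by ε (an involution)
    have e4 : fd (c * w k * c⁻¹) (centreElem (z k) * w k) = fd (w k) (centreElem (z k) * c * w k * c⁻¹) := by
      rw [← fd_mul_left (centreElem (z k)) (c * w k * c⁻¹) (centreElem (z k) * w k)]
      rw [show centreElem (z k) * (centreElem (z k) * w k) = w k by rw [← mul_assoc, centreElem_mul_self, one_mul], fd_comm]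
      rw [show centreElem (z k) * (c * w k * c⁻¹) = centreElem (z k) * c * w k * c⁻¹ by simp only [mul_assoc]]
    rw [e4]
    calc fd (w k) (centreElem (z k) * c * w k * c⁻¹)
        ≤ fd (w k) (centreElem (z k) * sl m * w k * c⁻¹) + fd (centreElem (z k) * sl m * w k * c⁻¹) (centreElem (z k) * c * w k * c⁻¹) := fd_triangle _ _ _
      _ ≤ ρ + 3 * ((L : ℝ) - 1) * ρ := by rw [h2]; exact add_le_add h1 h3
      _ ≤ 12 * (L : ℝ) ^ 2 * δ := by rw [hρ]; nlinarith
  -- the quaternion data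
  have hη0 : 0 ≤ 20 * (L : ℝ) ^ 2 * δ := by positivity
  have hcommq : ∀ i j, ‖su2Quat (w i) * su2Quat (w j) - su2Quat (w j) * su2Quat (w i)‖ ≤ 20 * (L : ℝ) ^ 2 * δ := fun i j =>
    (norm_quat_comm_le_fd (w i) (w j)).trans (hww i j)
  have h1220 : 12 * (L : ℝ) ^ 2 * δ ≤ 20 * (L : ℝ) ^ 2 * δ := by nlinarith only [hδ0, sq_nonneg (L : ℝ)]
  have htwq : ∀ k, z k = true → ‖su2Quat c * su2Quat (w k) + su2Quat (w k) * su2Quat c‖ ≤ 20 * (L : ℝ) ^ 2 * δ := by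
    intro k hk
    have h := (norm_quat_twist_le_fd c (w k) (z k)).trans ((hcw k).trans h1220)
    simpa only [hk, if_true, sub_neg_eq_add] using h
  have hunq : ∀ k, z k = false → ‖su2Quat c * su2Quat (w k) - su2Quat (w k) * su2Quat c‖ ≤ 20 * (L : ℝ) ^ 2 * δ := by
    intro k hk
    have h := (norm_quat_twist_le_fd c (w k) (z k)).trans ((hcw k).trans h1220)
    simpa only [hk, Bool.false_eq_true, if_false] using h
  obtain ⟨a', u', ha', hu', hu'c, hu't, hu'u, hda, hdu⟩ := exists_twisted_solution_near (su2Quat c) (fun k => su2Quat (w k)) z k₀ hk₀ hη0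
    (norm_su2Quat c) (fun k => norm_su2Quat (w k)) hcommq htwq hunq
  -- back to SU(2)
  obtain ⟨Y, hYq, -⟩ := exists_su2_family_of_unit_quaternions (fun o : Option (Fin 3) => Option.elim o a' u')
    (fun o => by cases o with | none => exact ha' | some k => exact hu' k)
  set c' : SU2 := Y none with hc'
  set w' : Fin 3 → SU2 := fun k => Y (some k) with hw'
  have hqc' : su2Quat c' = a' := hYq none
  have hqw' : ∀ k, su2Quat (w' k) = u' k := fun k => hYq (some k)
  have hinj := Literature.MathematicalPhysics.QuantumFieldTheory.Balaban1983to89.T4WilsonGaugeFlatDirection.su2Quat_injective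
  have hw'c : ∀ i j, w' i * w' j = w' j * w' i := fun i j => hinj (by rw [su2Quat_mul, su2Quat_mul, hqw', hqw', hu'c])
  have hc'w' : ∀ k, c' * w' k * c'⁻¹ = centreElem (z k) * w' k := by
    intro k
    have hrel : c' * w' k = centreElem (z k) * w' k * c' := by
      apply hinj
      rw [su2Quat_mul, su2Quat_mul, su2Quat_mul, hqc', hqw']
      cases hk : z k
      · rw [hu'u k hk]; simp [centreElem, su2Quat_one]
      · rw [hu't k hk]; simp [centreElem, su2Quat_negOne]
    rw [hrel, mul_inv_cancel_right]
  -- distances in SU(2)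
  have hdc : fd c c' ≤ 160 * (L : ℝ) ^ 2 * δ := by
    refine (fd_le_two_mul_norm_su2Quat_sub c c').trans ?_
    rw [hqc']; nlinarith [hda]
  have hdw : ∀ k, fd (w k) (w' k) ≤ 160 * (L : ℝ) ^ 2 * δ := fun k => by
    refine (fd_le_two_mul_norm_su2Quat_sub (w k) (w' k)).trans ?_
    rw [hqw']; nlinarith [hdu k]
  -- the flat twisted ring
  set F : GaugeConfig 3 L SU2 := combFlat w' with hF
  have hSF : wilsonAction su2Rep F = 0 := wilsonAction_combFlat_eq_zero hw'c
  refine ⟨(fun _ => gaugeTransform t⁻¹ F, fun x => (t x)⁻¹ * (lam x * c') * t x), ?_, ?_, ?_⟩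
  · -- deficit zero
    rw [ringDeficit_eq_sums]
    dsimp only
    -- the twisted seam reproduces the slice
    have hkey : gaugeTransform (fun x => lam x * c') (twist3 z F) = F := by
      funext e
      obtain ⟨x, k⟩ := e
      rw [show gaugeTransform (fun x => lam x * c') (twist3 z F) (x, k) = lam x * c' * twist3 z F (x, k) * (lam (x.shift k) * c')⁻¹ from rfl,
        twist3_apply, hF, combFlat_apply]
      dsimp only
      by_cases h0 : x k = 0
      · -- plane link: `F = 1` (as `0 ≠ −1`), twist factor and sign jump cancel
        haveI : Fact (1 < L) := ⟨hL⟩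
        have hne : x k ≠ -1 := by
          rw [h0]; intro h
          have : ((1 : ZMod L)) = 0 := by rw [← neg_neg (1 : ZMod L), ← h, neg_zero]
          have hv := ZMod.val_one L
          rw [this, ZMod.val_zero] at hv
          exact zero_ne_one hv
        rw [if_pos h0, if_neg hne, hlamflip x k (Or.inl h0), mul_one, mul_inv_rev, mul_inv_rev, centreElem_inv]
        have hεc := centre_comm (centreElem_mem_center (z k))
        calc lam x * c' * centreElem (z k) * (c'⁻¹ * (centreElem (z k) * (lam x)⁻¹))
            = lam x * (c' * centreElem (z k) * c'⁻¹) * (centreElem (z k) * (lam x)⁻¹) := by simp only [mul_assoc]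
          _ = lam x * centreElem (z k) * (centreElem (z k) * (lam x)⁻¹) := by
              rw [← hεc c', mul_assoc (centreElem (z k)) c' c'⁻¹, mul_inv_cancel, mul_one]
          _ = 1 := by rw [mul_assoc, ← mul_assoc (centreElem (z k)), centreElem_mul_self, one_mul, mul_inv_cancel]
      · by_cases h1 : x k = -1
        · -- wrap link: `F = w'_k`, twist factor `1`, sign jump `centreElem (z k)`
          rw [if_neg h0, if_pos h1, one_mul, hlamflip x k (Or.inr h1), mul_inv_rev, mul_inv_rev, centreElem_inv]
          have hεc := centre_comm (centreElem_mem_center (z k))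
          calc lam x * c' * w' k * (c'⁻¹ * (centreElem (z k) * (lam x)⁻¹))
              = lam x * (c' * w' k * c'⁻¹) * centreElem (z k) * (lam x)⁻¹ := by simp only [mul_assoc]
            _ = lam x * (centreElem (z k) * w' k) * centreElem (z k) * (lam x)⁻¹ := by rw [hc'w']
            _ = lam x * w' k * (lam x)⁻¹ := by
                rw [hεc (w' k), mul_assoc (lam x), mul_assoc (w' k), centreElem_mul_self, mul_one]
            _ = w' k := by rw [hlcomm x (w' k), mul_inv_cancel_right]
        · -- interior link: everything is `1`
          rw [if_neg h0, if_neg h1, one_mul, mul_one, hlamstay x k h0 h1, mul_inv_cancel]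
    have hseamQ : gaugeTransform (fun x => (t x)⁻¹ * (lam x * c') * t x) (twist3 z (gaugeTransform t⁻¹ F)) = gaugeTransform t⁻¹ F := by
      rw [← gaugeTransform_twist3, gaugeTransform_gaugeTransform]
      have e1 : ((fun x => (t x)⁻¹ * (lam x * c') * t x) * t⁻¹ : Site 3 L → SU2) = t⁻¹ * fun x => lam x * c' := by
        funext x; simp only [Pi.mul_apply, Pi.inv_apply, mul_inv_cancel_right]
      rw [e1, ← gaugeTransform_gaugeTransform, hkey]
    rw [hseamQ, timeCoupling_deficit_self, wilsonAction_gaugeTransform, hSF]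
    simp
  · -- slices
    intro i e
    have e1 : fd (P.1 i e) (gaugeTransform t⁻¹ F e) = fd (gaugeTransform t (P.1 i) e) (F e) := by
      have h := fd_gaugeTransform_apply t (P.1 i) (gaugeTransform t⁻¹ F) e
      rw [gaugeTransform_gaugeTransform_inv] at h
      exact h.symm
    rw [e1]
    have h1 : fd (gaugeTransform t (P.1 i) e) (gaugeTransform t U e) ≤ 4 * (L : ℝ) * δ := by rw [fd_gaugeTransform_apply]; exact hslice i e
    have h2 := hVw e
    have h3 : fd (combFlat w e) (F e) ≤ 160 * (L : ℝ) ^ 2 * δ := by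
      rw [hF, combFlat_apply, combFlat_apply]
      split_ifs with hx
      · exact hdw e.2
      · rw [fd_self]; positivity
    calc fd (gaugeTransform t (P.1 i) e) (F e)
        ≤ fd (gaugeTransform t (P.1 i) e) (gaugeTransform t U e) + (fd (gaugeTransform t U e) (combFlat w e) + fd (combFlat w e) (F e)) :=
          (fd_triangle _ _ _).trans (add_le_add le_rfl (fd_triangle _ _ _))
      _ ≤ 4 * (L : ℝ) * δ + (12 * (L : ℝ) ^ 2 * δ + 160 * (L : ℝ) ^ 2 * δ) := add_le_add h1 (add_le_add (hV ▸ h2) h3)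
      _ ≤ 176 * (L : ℝ) ^ 2 * δ := by nlinarith
  · -- seam
    intro x
    have e0 : t x * ((t x)⁻¹ * (lam x * c') * t x) * (t x)⁻¹ = lam x * c' := by
      simp only [mul_assoc, mul_inv_cancel_left, mul_inv_cancel, mul_one]
    have e1 : fd (g x) ((t x)⁻¹ * (lam x * c') * t x) = fd (sl x) c' := by
      have h1 : fd (g x) ((t x)⁻¹ * (lam x * c') * t x) = fd (s x) (lam x * c') := by
        rw [hs]; dsimp only
        conv_rhs => rw [← e0]
        rw [fd_mul_right, fd_mul_left]
      rw [h1, ← fd_mul_left (lam x)⁻¹ (s x) (lam x * c'), inv_mul_cancel_left]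
    rw [e1]
    calc fd (sl x) c' ≤ fd (sl x) c + fd c c' := fd_triangle _ _ _
      _ ≤ 3 * ((L : ℝ) - 1) * ρ + 160 * (L : ℝ) ^ 2 * δ := add_le_add (hslc x) hdc
      _ ≤ 172 * (L : ℝ) ^ 2 * δ := by rw [hρ]; nlinarith

/-! ## §2 ★★★ The crux -/

/-- ★★★ **Crux `QuadraticGrowth` (item stmt-QuantumFields-24320): quadratic growth of the twisted periodic deficit off its (rigid) zero set.**
For every `L ≥ 2`, every twist `z ≠ 0` and every ring history `P` (no smallness needed): the squared chordal ring distance from `P` to `{F_z = 0}` is at most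
`250000·L⁸·F_z(P)`. [cite: Luscher1983, §2] -/
theorem quadraticGrowth_holds : Summit.QuantumFields.YangMills.Theses.TwistEaterVolume.QuadraticGrowth := by
  refine ⟨250000, by norm_num, 8, by norm_num, 2, ?_⟩
  intro L _ hL z hz P _
  have h8 : ((L : ℝ) ^ (8 : ℝ)) = (L : ℝ) ^ (8 : ℕ) := by
    rw [show (8 : ℝ) = ((8 : ℕ) : ℝ) by norm_num, Real.rpow_natCast]
  rw [h8]
  set ε := ringDeficit L z P with hε
  have hε0 : 0 ≤ ε := ringDeficit_nonneg _ _
  have hL1 : (1 : ℝ) ≤ L := by exact_mod_cast NeZero.one_le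
  set δ := Real.sqrt ε with hδ
  have hδ0 : 0 ≤ δ := Real.sqrt_nonneg _
  have hδ2 : δ ^ 2 = ε := Real.sq_sqrt hε0
  obtain ⟨Q, hQ0, hQ1, hQ2⟩ := exists_flat_twisted_ring_near hL z hz P
  -- the value at `Q`
  have hval : (∑ i : Fin (2 * L - 1 + 1), (6 * (L : ℝ) ^ 3 - timeCoupling su2Rep (P.1 i) (Q.1 i))) +
      ∑ x : Site 3 L, (2 - ((su2Rep (P.2 x * (Q.2 x)⁻¹)).trace).re) ≤ 250000 * (L : ℝ) ^ 8 * ε := by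
    have hs1 : ∀ i : Fin (2 * L - 1 + 1), 6 * (L : ℝ) ^ 3 - timeCoupling su2Rep (P.1 i) (Q.1 i) ≤ 3 * (L : ℝ) ^ 3 * (176 * (L : ℝ) ^ 2 * δ) ^ 2 := fun i => by
      rw [timeCoupling_deficit_eq]
      calc ∑ e : Edge 3 L, ‖su2Quat (P.1 i e) - su2Quat (Q.1 i e)‖ ^ 2 ≤ ∑ _e : Edge 3 L, (176 * (L : ℝ) ^ 2 * δ) ^ 2 :=
            Finset.sum_le_sum fun e _ => (norm_su2Quat_sub_sq_le_fd_sq _ _).trans (pow_le_pow_left₀ (frobNorm_nonneg _) (hQ1 i e) 2)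
        _ = 3 * (L : ℝ) ^ 3 * (176 * (L : ℝ) ^ 2 * δ) ^ 2 := by rw [Finset.sum_const, Finset.card_univ, nsmul_eq_mul, ConstTube.card_edge_three L]
    have hs2 : ∀ x : Site 3 L, 2 - ((su2Rep (P.2 x * (Q.2 x)⁻¹)).trace).re ≤ (172 * (L : ℝ) ^ 2 * δ) ^ 2 := fun x => by
      rw [ConstTube.re_trace_su2Rep_mul_inv_eq_norm]
      have := (norm_su2Quat_sub_sq_le_fd_sq (P.2 x) (Q.2 x)).trans (pow_le_pow_left₀ (frobNorm_nonneg _) (hQ2 x) 2)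
      linarith
    have hcardI : (Fintype.card (Fin (2 * L - 1 + 1)) : ℝ) = 2 * (L : ℝ) := by
      rw [Fintype.card_fin]
      have hL' : 1 ≤ L := NeZero.one_le
      rw [show 2 * L - 1 + 1 = 2 * L by omega]; push_cast; ring
    have hcardS : (Fintype.card (Site 3 L) : ℝ) = (L : ℝ) ^ 3 := by
      rw [Fintype.card_pi, Finset.prod_const, Finset.card_univ, Fintype.card_fin, ZMod.card]; push_cast; ring
    have hA : (∑ i : Fin (2 * L - 1 + 1), (6 * (L : ℝ) ^ 3 - timeCoupling su2Rep (P.1 i) (Q.1 i))) ≤ 2 * (L : ℝ) * (3 * (L : ℝ) ^ 3 * (176 * (L : ℝ) ^ 2 * δ) ^ 2) := by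
      calc (∑ i : Fin (2 * L - 1 + 1), (6 * (L : ℝ) ^ 3 - timeCoupling su2Rep (P.1 i) (Q.1 i)))
          ≤ ∑ _i : Fin (2 * L - 1 + 1), 3 * (L : ℝ) ^ 3 * (176 * (L : ℝ) ^ 2 * δ) ^ 2 := Finset.sum_le_sum fun i _ => hs1 i
        _ = 2 * (L : ℝ) * (3 * (L : ℝ) ^ 3 * (176 * (L : ℝ) ^ 2 * δ) ^ 2) := by rw [Finset.sum_const, Finset.card_univ, nsmul_eq_mul, hcardI]
    have hB : ∑ x : Site 3 L, (2 - ((su2Rep (P.2 x * (Q.2 x)⁻¹)).trace).re) ≤ (L : ℝ) ^ 3 * (172 * (L : ℝ) ^ 2 * δ) ^ 2 := by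
      calc ∑ x : Site 3 L, (2 - ((su2Rep (P.2 x * (Q.2 x)⁻¹)).trace).re) ≤ ∑ _x : Site 3 L, (172 * (L : ℝ) ^ 2 * δ) ^ 2 := Finset.sum_le_sum fun x _ => hs2 x
        _ = (L : ℝ) ^ 3 * (172 * (L : ℝ) ^ 2 * δ) ^ 2 := by rw [Finset.sum_const, Finset.card_univ, nsmul_eq_mul, hcardS]
    have harith : 2 * (L : ℝ) * (3 * (L : ℝ) ^ 3 * (176 * (L : ℝ) ^ 2 * δ) ^ 2) + (L : ℝ) ^ 3 * (172 * (L : ℝ) ^ 2 * δ) ^ 2 ≤ 250000 * (L : ℝ) ^ 8 * ε := by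
      have e1 : 2 * (L : ℝ) * (3 * (L : ℝ) ^ 3 * (176 * (L : ℝ) ^ 2 * δ) ^ 2) + (L : ℝ) ^ 3 * (172 * (L : ℝ) ^ 2 * δ) ^ 2 =
          (185856 * (L : ℝ) ^ 8 + 29584 * (L : ℝ) ^ 7) * ε := by rw [← hδ2]; ring
      rw [e1]
      have hL7 : (L : ℝ) ^ 7 ≤ (L : ℝ) ^ 8 := by
        rw [show (L : ℝ) ^ 8 = (L : ℝ) ^ 7 * L by ring]
        nlinarith [pow_pos (by linarith : (0 : ℝ) < L) 7]
      nlinarith [pow_nonneg (by linarith : (0 : ℝ) ≤ L) 8, mul_nonneg (sub_nonneg.2 hL7) hε0]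
    linarith
  refine le_trans (csInf_le ?_ ⟨Q, hQ0, rfl⟩) hval
  refine ⟨0, ?_⟩
  rintro _ ⟨Q', -, rfl⟩
  exact add_nonneg (Finset.sum_nonneg fun i _ => by linarith [timeCoupling_su2Rep_le (P.1 i) (Q'.1 i)])
    (Finset.sum_nonneg fun x _ => by
      rw [ConstTube.re_trace_su2Rep_mul_inv_eq_norm]; nlinarith [sq_nonneg ‖su2Quat (P.2 x) - su2Quat (Q'.2 x)‖])

end Summit.QuantumFields.YangMills.Theorems.TwistEaterVolume.Quadratic

namespace Summit.QuantumFields.YangMills.Theorems.TwistEaterVolume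

/-- ★★★ **The crux `TwistEaterVolume.QuadraticGrowth` by name** (item stmt-QuantumFields-24320): `K = 250000`, `q = 8`, `L₀ = 2`. [cite: Luscher1983, §2] -/
theorem quadraticGrowth_proof : Summit.QuantumFields.YangMills.Theses.TwistEaterVolume.QuadraticGrowth :=
  Quadratic.quadraticGrowth_holds

end Summit.QuantumFields.YangMills.Theorems.TwistEaterVolume

end
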